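import Summits.QuantumFields.YangMills.Theorems.BalabanUVNodesN19CoreCommonStep

/-!
# BalabanUVNodes ∕ N19 (NE7) — `…N19CoreCommonStep` §4 IS INHABITED NON-DEGENERATELY: a two-class toy in which `K` common steps of diameter `log 4`
# turn an `O(1)` class-birth into the GEOMETRIC rate `3^{−K}` (`= tanh(Δ∕4)^K` exactly, Birkhoff's coefficient attained) and N19's edge follows

Cell `pub-ymgap` (HUMAN RULING D-0062 Track A; D-0149 width seats), seat `pub-ymgap-dag-n19-w2` (WIDTH SEAT 2 of 3 on NODE n19 = NE7), generation g6.
Route `Summits/QuantumFields/YangMills/Theses/BalabanUVNodes.lean`, key item K3⁷ `SpineGivenEndpointR13SepCoPH` (stmt-QuantumFields-20544); filed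
`--kind proof --supports … --as helper`.  COUNT-NEUTRAL.  THEOREMS ONLY (0 `def`, 0 `sorry`).  ADDITIVE — imports this seat's g6 `…N19CoreCommonStep` (p618919:
`coreEdge_of_totals_of_commonSteps`, `classOsc_chain_le_pow`) ONLY; modifies nothing.

THE TOY (A6 hygiene: a NON-DEGENERATE inhabitant of every hypothesis of `coreEdge_of_totals_of_commonSteps` at once, with the contraction rate ATTAINED).  Two classes
(`Fin 2`), every level `K`, every step `j`, every source `t`: the common step `M = [[2,1],[1,2]]` (positive, cross-ratio diameter `Δ = log 4`, so `tanh(Δ∕4) = 1∕3`);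
run A starts at `X₀ = (1,1)`, run B at `Y₀ = (e,1)` (class-birth `ω₀ = 1`, NOT small); after `j` common steps `X_j = 3^j·(1,1)` and
`Y_j = (((e+1)3^j + (e−1))∕2, ((e+1)3^j − (e−1))∕2)` (eigen-decomposition of `M`: eigenvalues `3` on `(1,1)` and `1` on `(1,−1)`), so the class log-ratio oscillation after
`K` steps is `log(((e+1)3^K + (e−1))∕((e+1)3^K − (e−1))) ≍ (2(e−1)∕(e+1))·3^{−K}` — EXACTLY Birkhoff's rate `tanh(Δ∕4)^K = 3^{−K}` up to the constant — while the TOTALS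
`Σ X_K = 2·3^K`, `Σ Y_K = (e+1)·3^K` match modulo the constant `log((e+1)∕2)` with ZERO remainder (source-independent toy: the source half is empty here by design).
* `toy_step_X` ∕ `toy_step_Y` (the recursion `X_{j+1} = M•X_j`, `Y_{j+1} = M•Y_j` holds) · `toy_pos_Y` · `toy_diam` (cross-ratios `≤ e^{log 4}`) · `toy_osc0` (initial class-oscillation `≤ 1`) ·
  `toy_totals` (totals matched, `δ ≡ 0`) · ★★ `toy_coreEdge` — `coreEdge_of_totals_of_commonSteps` FIRES: `∃ δ′, NE7.Core 1 1 univ ∅ (K t s ↦ X K K t s) (K t s ↦ Y K K t s) δ′ ∧ Summable δ′`.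

HONEST FRAMING.  A TOY: two classes, a constant doubly-stochastic-like positive matrix; it shows only that the hypotheses of p618919 §4 are jointly satisfiable with a non-zero class-birth and
that the mechanism's rate is the true one there.  ZERO Bałaban content; nothing of [Balaban1988Convergent] ∕ [LF-I] ∕ [LF-II] instantiated; N19 NOT discharged; K3⁷ OPEN, v5 untouched, not
claimed; counts UNMOVED (typed 28∕28 · discharged 5∕27, A 5∕28); no count claim.  R4 closes the conditional finite-𝕋⁴ rung `BalabanLadder.UV` only — the YM mass gap (Clay) is NOT proved by any
of this; nothing continuum ∕ ℝ⁴ ∕ OS.  No `def`, no `instance`, no `sorry`; standard axioms.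
-/

noncomputable section

open Finset Real
open Summit.QuantumFields.BalabanUV.T4Continuum.Spine
open Summit.QuantumFields.YangMills.BalabanUVNodes.N19CoreCommonStep (coreEdge_of_totals_of_commonSteps)

namespace Summit.QuantumFields.YangMills.BalabanUVNodes.N19CoreCommonStepToy

/-- run A's vector after `j` steps is `3^j·(1,1)`: the recursion `X_{j+1} s = Σ_{s′} M s s′ · X_j s′`. [folklore] -/
theorem toy_step_X (j : ℕ) (s : Fin 2) :
    (3 : ℝ) ^ (j + 1) = ∑ s' : Fin 2, (if s = s' then (2 : ℝ) else 1) * (3 : ℝ) ^ j := by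
  fin_cases s <;> simp [Fin.sum_univ_two] <;> ring

/-- run B's vector after `j` steps is `(((e+1)3^j + (e−1))∕2, ((e+1)3^j − (e−1))∕2)`: the recursion `Y_{j+1} s = Σ_{s′} M s s′ · Y_j s′`. [folklore] -/
theorem toy_step_Y (j : ℕ) (s : Fin 2) :
    ((exp 1 + 1) * (3 : ℝ) ^ (j + 1) + (if s = 0 then 1 else -1) * (exp 1 - 1)) / 2 =
      ∑ s' : Fin 2, (if s = s' then (2 : ℝ) else 1) * (((exp 1 + 1) * (3 : ℝ) ^ j + (if s' = 0 then 1 else -1) * (exp 1 - 1)) / 2) := by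
  fin_cases s <;> simp [Fin.sum_univ_two] <;> ring

/-- run B's entries are positive. [folklore] -/
theorem toy_pos_Y (j : ℕ) (s : Fin 2) : 0 < ((exp 1 + 1) * (3 : ℝ) ^ j + (if s = 0 then 1 else -1) * (exp 1 - 1)) / 2 := by
  have h3 : (1 : ℝ) ≤ 3 ^ j := one_le_pow₀ (by norm_num)
  have he : 0 < exp (1 : ℝ) := exp_pos 1
  fin_cases s <;> simp <;> nlinarith

/-- the toy step is positive with cross-ratio diameter `≤ log 4`: `M s s′·M r r′ ≤ 4·M s r′·M r s′`. [folklore] -/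
theorem toy_diam (s r s' r' : Fin 2) :
    (if s = s' then (2 : ℝ) else 1) * (if r = r' then (2 : ℝ) else 1) ≤
      exp (Real.log 4) * ((if s = r' then (2 : ℝ) else 1) * (if r = s' then (2 : ℝ) else 1)) := by
  rw [Real.exp_log (by norm_num : (0 : ℝ) < 4)]
  fin_cases s <;> fin_cases r <;> fin_cases s' <;> fin_cases r' <;> simp <;> norm_num

/-- the initial class-oscillation of `log(Y₀∕X₀) = (1, 0)` is `≤ 1` (`Y₀ = (e, 1)`, `X₀ = (1, 1)`). [folklore] -/
theorem toy_osc0 (s s' : Fin 2) :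
    (Real.log (((exp 1 + 1) * (3 : ℝ) ^ 0 + (if s = 0 then 1 else -1) * (exp 1 - 1)) / 2) - Real.log ((3 : ℝ) ^ 0)) -
      (Real.log (((exp 1 + 1) * (3 : ℝ) ^ 0 + (if s' = 0 then 1 else -1) * (exp 1 - 1)) / 2) - Real.log ((3 : ℝ) ^ 0)) ≤ 1 := by
  have e1 : (exp 1 + 1 + (1 - exp 1)) / 2 = (1 : ℝ) := by ring
  fin_cases s <;> fin_cases s' <;> simp [e1, Real.log_exp]

/-- the totals match modulo the constant `log((e+1)∕2)` with ZERO remainder: `Σ X_K = 2·3^K`, `Σ Y_K = (e+1)·3^K`. [folklore] -/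
theorem toy_totals (K : ℕ) :
    Real.exp (Real.log ((exp 1 + 1) / 2) - 1 * 0) * ∑ _s : Fin 2, (3 : ℝ) ^ K ≤
        ∑ s : Fin 2, ((exp 1 + 1) * (3 : ℝ) ^ K + (if s = 0 then 1 else -1) * (exp 1 - 1)) / 2 ∧
      ∑ s : Fin 2, ((exp 1 + 1) * (3 : ℝ) ^ K + (if s = 0 then 1 else -1) * (exp 1 - 1)) / 2 ≤
        Real.exp (Real.log ((exp 1 + 1) / 2) + 1 * 0) * ∑ _s : Fin 2, (3 : ℝ) ^ K := by
  have hpos : 0 < (exp 1 + 1) / 2 := by positivity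
  rw [mul_zero, sub_zero, add_zero, Real.exp_log hpos]
  simp only [Fin.sum_univ_two, Fin.isValue, if_true, one_ne_zero, if_false]
  constructor <;> nlinarith

/-- **★★ THE EDGE FIRES ON THE TOY** [folklore]: every hypothesis of p618919 `coreEdge_of_totals_of_commonSteps` is met (classes `Fin 2`, `vol = 1`, `l₀ = 1`, `ω₀ = 1`, `Δ = log 4`,
step `[[2,1],[1,2]]` at every `(K, j, t)`, `X_j = 3^j(1,1)`, `Y_j = (((e+1)3^j ± (e−1))∕2)`, totals matched at `δ ≡ 0`), hence
`∃ δ′, NE7.Core 1 1 (fun _ ↦ univ) (fun _ _ ↦ ∅) (K t s ↦ X K K t s) (K t s ↦ Y K K t s) δ′ ∧ Summable δ′` — a non-degenerate inhabitant (class-birth `ω₀ = 1 ≠ 0`). -/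
theorem toy_coreEdge :
    ∃ δ' : ℕ → ℝ, NE7.Core 1 1 (fun _ => (Finset.univ : Finset (Fin 2))) (fun _ _ => ∅)
      (fun K (_ : ℝ) (_ : Fin 2) => (3 : ℝ) ^ K)
      (fun K (_ : ℝ) (s : Fin 2) => ((exp 1 + 1) * (3 : ℝ) ^ K + (if s = 0 then 1 else -1) * (exp 1 - 1)) / 2) δ' ∧ Summable δ' := by
  have h := coreEdge_of_totals_of_commonSteps (σ := Fin 2) (l₀ := 1) (vol := 1) (ω₀ := 1) (Δ := Real.log 4)
    (S := fun _ => (Finset.univ : Finset (Fin 2)))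
    (M := fun _ _ _ s s' => if s = s' then (2 : ℝ) else 1)
    (X := fun _ j _ _ => (3 : ℝ) ^ j)
    (Y := fun _ j _ s => ((exp 1 + 1) * (3 : ℝ) ^ j + (if s = 0 then 1 else -1) * (exp 1 - 1)) / 2)
    one_pos zero_le_one (Real.log_nonneg (by norm_num))
    (fun K j t _ s _ s' _ => by
      show (0 : ℝ) < if s = s' then 2 else 1
      split_ifs <;> norm_num)
    (fun K j t _ s _ r _ s' _ r' _ => toy_diam s r s' r')
    (fun K t _ s _ => by positivity) (fun K t _ s _ => toy_pos_Y 0 s)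
    (fun K j t _ s _ => toy_step_X j s) (fun K j t _ s _ => toy_step_Y j s)
    (fun K t _ s _ s' _ => toy_osc0 s s')
    ⟨fun _ => 0, fun K => ⟨Real.log ((exp 1 + 1) / 2), fun t _ => toy_totals K⟩, summable_zero⟩
  exact h

end Summit.QuantumFields.YangMills.BalabanUVNodes.N19CoreCommonStepToy

end
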